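import Mathlib.Analysis.Calculus.FDeriv.Equiv
import Mathlib.Analysis.Calculus.FDeriv.Prod
import Mathlib.Topology.Algebra.Module.FiniteDimension
import Mathlib.Analysis.Normed.Module.FiniteDimension
import Mathlib.Analysis.InnerProductSpace.PiL2
import HarnessLib

/-!
# Splitting the coordinates of `ℝᴺ` along a selection of columns

Family `periods` (periods.S27), topic `Literature/Analysis/Calculus`: bookkeeping for the implicit
function chart in Wilkie's desingularisation theorem (den Besten 2016, proof of Thm. 3.2.7: "there
exists a set `S ⊆ {1, …, n}` of size `m` such that the matrix `(∂fᵢ/∂xⱼ(P₀))_{1 ≤ i ≤ m, j ∈ S}`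
has a nonzero determinant … we write `P₀ = (P, Q)` with `P ∈ Kʳ` and `Q ∈ Kᵐ`").

Given an injective selection `c : Fin m → Fin N` of coordinates of `ℝᴺ = Fin N → ℝ`:

* `Free c` — the complementary coordinates `{k // k ∉ range c}`;
* `glue c hc z y` — the point of `ℝᴺ` with free coordinates `z` and selected coordinates `y`,
  `splitEquiv c hc : ℝᴺ ≃L[ℝ] (Free c → ℝ) × (Fin m → ℝ)` (`x ↦ (x|_{free}, x ∘ c)`, inverse
  `glue`), with the evaluation lemmas;
* the chain rule for `Φ ∘ (splitEquiv c hc).symm`: the partial derivatives along the two factors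
  are the partial derivatives of `Φ` along the corresponding coordinates of `ℝᴺ`
  (`fderiv_comp_symm_inl_single`, `fderiv_comp_symm_inr_single`).

Everything here is proved.

## References

* M. den Besten, *Wilkie's Theorem and the Uniform Real Schanuel Conjecture*, MSc thesis, Utrecht
  (2016), proof of Thm. 3.2.7.
-/

noncomputable section

open scoped Topology
open Set

namespace Literature.Analysis.Calculus

variable {N m : ℕ} (c : Fin m → Fin N) (hc : Function.Injective c)

/-- The coordinates of `ℝᴺ` not selected by `c`. [folklore] -/
abbrev Free : Type := {k : Fin N // k ∉ Set.range c}

open Classical in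
/-- **Gluing**: the point of `ℝᴺ` with free coordinates `z` and selected coordinates `y`
(`(glue z y) (c l) = y l`, `(glue z y) j = z j` for `j` free). [folklore] -/
def glue (z : Free c → ℝ) (y : Fin m → ℝ) : Fin N → ℝ :=
  fun k => if h : k ∈ Set.range c then y ((Equiv.ofInjective c hc).symm ⟨k, h⟩) else z ⟨k, h⟩

/-- `glue` on a selected coordinate. [folklore] -/
@[simp] theorem glue_apply_c (z : Free c → ℝ) (y : Fin m → ℝ) (l : Fin m) : glue c hc z y (c l) = y l := by
  unfold glue
  rw [dif_pos ⟨l, rfl⟩]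
  congr 1
  exact Equiv.ofInjective_symm_apply hc l

/-- `glue` on a free coordinate. [folklore] -/
@[simp] theorem glue_apply_free (z : Free c → ℝ) (y : Fin m → ℝ) (j : Free c) : glue c hc z y j.1 = z j := by
  unfold glue
  rw [dif_neg j.2]

/-- **Splitting**: `x ↦ (x|_{free}, x ∘ c)`. [folklore] -/
def splitFun (x : Fin N → ℝ) : (Free c → ℝ) × (Fin m → ℝ) := (fun j => x j.1, fun l => x (c l))

/-- `glue` inverts `splitFun`. [folklore] -/
theorem glue_splitFun (x : Fin N → ℝ) : glue c hc (splitFun c x).1 (splitFun c x).2 = x := by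
  funext k
  by_cases h : k ∈ Set.range c
  · obtain ⟨l, rfl⟩ := h
    rw [glue_apply_c]; rfl
  · exact glue_apply_free c hc _ _ ⟨k, h⟩

/-- `splitFun` inverts `glue`. [folklore] -/
theorem splitFun_glue (z : Free c → ℝ) (y : Fin m → ℝ) : splitFun c (glue c hc z y) = (z, y) := by
  ext j
  · exact glue_apply_free c hc z y j
  · exact glue_apply_c c hc z y j

/-- **The coordinate splitting as a continuous linear equivalence**
`ℝᴺ ≃L (Free c → ℝ) × (Fin m → ℝ)`. [folklore] -/
def splitEquiv : (Fin N → ℝ) ≃L[ℝ] (Free c → ℝ) × (Fin m → ℝ) :=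
  LinearEquiv.toContinuousLinearEquiv
    { toFun := splitFun c
      invFun := fun p => glue c hc p.1 p.2
      map_add' := fun _ _ => rfl
      map_smul' := fun _ _ => rfl
      left_inv := fun x => glue_splitFun c hc x
      right_inv := fun p => splitFun_glue c hc p.1 p.2 }

/-- `splitEquiv x = (x|_{free}, x ∘ c)`: first component. [folklore] -/
@[simp] theorem splitEquiv_apply_fst (x : Fin N → ℝ) (j : Free c) : (splitEquiv c hc x).1 j = x j.1 := rfl
/-- `splitEquiv x = (x|_{free}, x ∘ c)`: second component. [folklore] -/
@[simp] theorem splitEquiv_apply_snd (x : Fin N → ℝ) (l : Fin m) : (splitEquiv c hc x).2 l = x (c l) := rfl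
/-- The inverse of `splitEquiv` is `glue`. [folklore] -/
@[simp] theorem splitEquiv_symm_apply (p : (Free c → ℝ) × (Fin m → ℝ)) :
    (splitEquiv c hc).symm p = glue c hc p.1 p.2 := rfl

/-- Gluing a free basis vector with `0`: the basis vector of `ℝᴺ`. [folklore] -/
theorem glue_single_zero (j : Free c) : glue c hc (Pi.single j 1) 0 = Pi.single j.1 1 := by
  funext k
  by_cases h : k ∈ Set.range c
  · obtain ⟨l, rfl⟩ := h
    rw [glue_apply_c, Pi.zero_apply, Pi.single_apply, if_neg]
    exact fun e => j.2 ⟨l, e⟩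
  · rw [show k = (⟨k, h⟩ : Free c).1 from rfl, glue_apply_free]
    by_cases hjk : (⟨k, h⟩ : Free c) = j
    · rw [hjk, Pi.single_eq_same, Pi.single_eq_same]
    · rw [Pi.single_apply, if_neg hjk, Pi.single_apply, if_neg]
      exact fun e => hjk (Subtype.ext e)

/-- Gluing `0` with a selected basis vector: the basis vector of `ℝᴺ`. [folklore] -/
theorem glue_zero_single (l : Fin m) : glue c hc 0 (Pi.single l 1) = Pi.single (c l) 1 := by
  funext k
  by_cases h : k ∈ Set.range c
  · obtain ⟨l', rfl⟩ := h
    rw [glue_apply_c]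
    by_cases hll : l' = l
    · rw [hll, Pi.single_eq_same, Pi.single_eq_same]
    · rw [Pi.single_apply, if_neg hll, Pi.single_apply, if_neg (fun e => hll (hc e))]
  · rw [show k = (⟨k, h⟩ : Free c).1 from rfl, glue_apply_free, Pi.zero_apply, Pi.single_apply, if_neg]
    rintro rfl; exact h ⟨l, rfl⟩

/-! ### The chain rule through the splitting -/

variable {G : Type*} [NormedAddCommGroup G] [NormedSpace ℝ G]

/-- The derivative of `Φ ∘ splitEquiv⁻¹` at `splitEquiv x` is `DΦ(x) ∘ splitEquiv⁻¹`. [folklore] -/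
theorem fderiv_comp_splitEquiv_symm (Φ : (Fin N → ℝ) → G) (x : Fin N → ℝ) :
    fderiv ℝ (Φ ∘ (splitEquiv c hc).symm) (splitEquiv c hc x) =
      fderiv ℝ Φ x ∘L ((splitEquiv c hc).symm : (Free c → ℝ) × (Fin m → ℝ) →L[ℝ] (Fin N → ℝ)) := by
  rw [ContinuousLinearEquiv.comp_right_fderiv, ContinuousLinearEquiv.symm_apply_apply]

/-- **Partial derivatives along the free factor** are the partial derivatives of `Φ` along the free
coordinates. [folklore] -/
theorem fderiv_comp_symm_inl_single (Φ : (Fin N → ℝ) → G) (x : Fin N → ℝ) (j : Free c) :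
    fderiv ℝ (Φ ∘ (splitEquiv c hc).symm) (splitEquiv c hc x)
      (ContinuousLinearMap.inl ℝ _ _ (Pi.single j 1)) = fderiv ℝ Φ x (Pi.single j.1 1) := by
  rw [fderiv_comp_splitEquiv_symm, ContinuousLinearMap.comp_apply, ContinuousLinearMap.inl_apply,
    ContinuousLinearEquiv.coe_coe, splitEquiv_symm_apply, glue_single_zero]

/-- **Partial derivatives along the selected factor** are the partial derivatives of `Φ` along
the selected coordinates. [folklore] -/
theorem fderiv_comp_symm_inr_single (Φ : (Fin N → ℝ) → G) (x : Fin N → ℝ) (l : Fin m) :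
    fderiv ℝ (Φ ∘ (splitEquiv c hc).symm) (splitEquiv c hc x)
      (ContinuousLinearMap.inr ℝ _ _ (Pi.single l 1)) = fderiv ℝ Φ x (Pi.single (c l) 1) := by
  rw [fderiv_comp_splitEquiv_symm, ContinuousLinearMap.comp_apply, ContinuousLinearMap.inr_apply,
    ContinuousLinearEquiv.coe_coe, splitEquiv_symm_apply, glue_zero_single]

end Literature.Analysis.Calculus

end
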